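import Summits.QuantumFields.YangMills.Theorems.AllWindowsColdBoxBoxHighLineSpectralFloorTools
import Literature.Probability.LatticeModels.DirichletLatticeGFF
import Summits.QuantumFields.YangMills.Theorems.AllWindowsColdBoxBoxHighWindowsSU22LineDefs

/-!
# Slab Poincaré on `ℤ^d` and the ℓ² spectral floor of the interior Dirichlet Laplacian `−Δ_I` on `interiorSites H = [1, 2H−1]⁴`
# (STUB-PLAN-S5U5-STEP1b §2 (4f), first clause `λ_min((−Δ_I)ᵀ(−Δ_I)) ≥ c·H⁻⁴`, here `c = 1/16`; LINE-19 S5 ⟨stmt-QuantumFields-24004⟩/⟨24335⟩, LINE-20 U5 ⟨24336⟩; part 2 of 3)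

Width seat `ym-line-sfw-p2-w4` (prover-ym-line-sfw-p2-w4-g27-0); an UNTABLED glue lemma additive to planner `ym-idea-2`'s brick table of
2026-08-29T17:07:29Z (the row-ℓ¹ bricks (4f-i)/(4f-ii) of `w5` are a different norm and are not touched; no Green-function decay is used here).

* **`sum_sq_le_sq_mul_sum_sq_sub_single`** — slab Poincaré on `ℤ^d`: a real function supported in a slab `a ≤ x_ν < a + p` has
  `Σ u² ≤ p² · Σ (u(x + e_ν) − u(x))²` over any finite window closed under the forward `ν`-translates of its support points (telescoping
  to the empty side of the slab + Cauchy–Schwarz; the folklore `λ₁(path of p sites) = 2 − 2cos(π/(p+1)) ≥ p⁻²` with a crude constant;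
  cf. the one-dimensional `…RotationJoining.Negative.sum_sq_le_sq_mul_sum_sq_sub_shift` of the CriticalPhenomena tree, whose proof pattern is followed).
* **`dotProduct_self_le_sq_mul_dotProduct_dirichletMatrix`** — for a finite `Λ ⊆ ℤ^d` in such a slab and every `v : Λ → ℝ`,
  `‖v‖² ≤ p² · vᵀ(dirichletMatrix Λ)v`, through the Literature Gram identity `vᵀ(−Δ_D)v = Σ_bonds |∇v̄|²`
  (`dotProduct_dirichletMatrix_mulVec`, `dirichletForm_eq_finsum_sq`, Glimm–Jaffe (9.5.10)).
* **The interior box** (`p = 2H − 1` in direction `0`): `interiorLaplacian_poincare` (`‖v‖² ≤ (2H−1)²·vᵀ(−Δ_I)v`), `interiorLaplacian_floor`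
  (`(1/4)/H²·‖v‖² ≤ vᵀ(−Δ_I)v`), **`interiorLaplacian_opFloor`** (`(1/16)/H⁴·‖v‖² ≤ ‖(−Δ_I)v‖²`), and the inverse bounds
  `vᵀ(−Δ_I)⁻¹v ≤ 4H²‖v‖²`, `‖(−Δ_I)⁻¹w‖² ≤ 16H⁴‖w‖²`.  Here `−Δ_I = dirichletMatrix (interiorSites H)` — the Gram matrix of the gauge modes by
  ✓`gradVec_dotProduct_gradVec` (`…GaugeGram`); part 3 transfers the same floors to the kernel files' `BoxKernel.boxLap (2H) univ`.
(Planner's instrument I20 for comparison: `λ_min·H²` of the Hodge matrix tends to `3π²/4`; for the scalar `−Δ_I` on `[1,2H−1]⁴` it is `4·(2−2cos(π/2H))·H² → π²`,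
so the constant `1/4` loses a factor `≈ 40`, irrelevant for the window bookkeeping `r₀H² → 0` of STEP1b §4.)

Everything proved; no definitions; standard axioms.  HONEST LABEL: an elementary, untabled glue lemma for step (1b) (Laplace asymptotics of the orbit average, STUB-PLAN-S5U5-STEP1b) of the XL stubs
S5 `stub_landauSecondOrder` / U5 `stub_landauThirdOrder` of critic-PASSed DRAFT lines on the R2ξ″ cruxes ⟨stmt-QuantumFields-24004⟩/⟨24335⟩/⟨24336⟩;
T-S5.4 proper, S5, U5 and those items remain OPEN; no stub is closed by name, no crux, rung or summit is proved; the Yang–Mills mass gap is NOT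
proved by this file.
-/

set_option autoImplicit false

open Finset Matrix
open Literature.Probability.LatticeModels

namespace Summit.QuantumFields.YangMills.Theorems.AllWindowsColdBoxBoxHighLine

namespace SpectralFloor

/-! ## Slab Poincaré on `ℤ^d` -/

variable {d : ℕ}

/-- The `ν`-coordinate of `x + i·e_ν` is `x_ν + i`. -/
theorem add_zsmul_single_apply_self (x : Site d) (ν : Fin d) (i : ℤ) :
    (x + i • (Pi.single ν (1 : ℤ) : Site d)) ν = x ν + i := by
  simp

/-- **Slab Poincaré inequality on `ℤ^d` (finite-window form).**  If `u` vanishes off the slab `a ≤ x_ν < a + p` and the finite window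
`K` contains, with every support point `x ∈ K`, the forward `ν`-translates `x + i·e_ν` (`i < p`), then
`Σ_{x ∈ K} u(x)² ≤ p² · Σ_{x ∈ K} (u(x + e_ν) − u(x))²`.  (Telescoping `u(x) = Σ_{i<p} (u(x+ie_ν) − u(x+(i+1)e_ν))` — the last point lies
beyond the slab — then Cauchy–Schwarz, and each translated window sum is dominated by the full one.) -/
theorem sum_sq_le_sq_mul_sum_sq_sub_single (u : Site d → ℝ) (ν : Fin d) (a : ℤ) (p : ℕ)
    (hsupp : ∀ x, u x ≠ 0 → a ≤ x ν ∧ x ν < a + p) (K : Finset (Site d))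
    (hK : ∀ x ∈ K, u x ≠ 0 → ∀ i : ℕ, i < p → x + (i : ℤ) • (Pi.single ν (1 : ℤ) : Site d) ∈ K) :
    ∑ x ∈ K, u x ^ 2 ≤ (p : ℝ) ^ 2 * ∑ x ∈ K, (u (x + Pi.single ν 1) - u x) ^ 2 := by
  classical
  set e : Site d := Pi.single ν 1 with he
  set D : Site d → ℝ := fun x => (u (x + e) - u x) ^ 2 with hD
  have hDnn : ∀ x, 0 ≤ D x := fun x => sq_nonneg _
  -- telescoping at a support point
  have htel : ∀ x, u x ≠ 0 →
      u x = ∑ i ∈ range p, (u (x + (i : ℤ) • e) - u (x + ((i + 1 : ℕ) : ℤ) • e)) := by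
    intro x hx
    have h := Finset.sum_range_sub' (fun i : ℕ => u (x + (i : ℤ) • e)) p
    have hzero : u (x + (p : ℤ) • e) = 0 := by
      by_contra hne
      have h1 := (hsupp _ hne).2
      have h2 := (hsupp _ hx).1
      rw [he, add_zsmul_single_apply_self] at h1
      linarith
    simp only [Nat.cast_zero, zero_smul, add_zero] at h
    rw [hzero, sub_zero] at h
    exact h.symm
  -- the telescoping steps are the differences `D` at the translates
  have hstep : ∀ (x : Site d) (i : ℕ),
      (u (x + (i : ℤ) • e) - u (x + ((i + 1 : ℕ) : ℤ) • e)) ^ 2 = D (x + (i : ℤ) • e) := by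
    intro x i
    have : x + ((i + 1 : ℕ) : ℤ) • e = x + (i : ℤ) • e + e := by
      rw [Nat.cast_succ, add_smul, one_smul, add_assoc]
    rw [hD, this, sub_sq_comm]
  -- Cauchy–Schwarz per support point
  have hpt : ∀ x, u x ≠ 0 → u x ^ 2 ≤ (p : ℝ) * ∑ i ∈ range p, D (x + (i : ℤ) • e) := by
    intro x hx
    have h1 := sq_sum_le_card_mul_sum_sq (s := range p)
      (f := fun i : ℕ => u (x + (i : ℤ) • e) - u (x + ((i + 1 : ℕ) : ℤ) • e))
    rw [← htel x hx, Finset.card_range] at h1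
    refine h1.trans (le_of_eq ?_)
    simp only [hstep]
  -- restrict the left sum to the support
  have hKJ : ∑ x ∈ K, u x ^ 2 = ∑ x ∈ K with u x ≠ 0, u x ^ 2 := by
    rw [Finset.sum_filter_of_ne]
    intro x _ hx
    exact fun h => hx (by rw [h]; ring)
  -- translated window sums are dominated by the full window sum
  have hshift : ∀ i ∈ range p, ∑ x ∈ K with u x ≠ 0, D (x + (i : ℤ) • e) ≤ ∑ x ∈ K, D x := by
    intro i hi
    rw [Finset.mem_range] at hi
    have hinj : Set.InjOn (fun x : Site d => x + (i : ℤ) • e) ↑(K.filter fun x => u x ≠ 0) :=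
      fun x _ y _ hxy => by simpa using hxy
    rw [← Finset.sum_image (f := D) hinj]
    refine Finset.sum_le_sum_of_subset_of_nonneg ?_ (fun x _ _ => hDnn x)
    intro y hy
    rw [Finset.mem_image] at hy
    obtain ⟨x, hx, rfl⟩ := hy
    rw [Finset.mem_filter] at hx
    exact hK x hx.1 hx.2 i hi
  calc ∑ x ∈ K, u x ^ 2 = ∑ x ∈ K with u x ≠ 0, u x ^ 2 := hKJ
    _ ≤ ∑ x ∈ K with u x ≠ 0, (p : ℝ) * ∑ i ∈ range p, D (x + (i : ℤ) • e) :=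
        Finset.sum_le_sum fun x hx => hpt x (Finset.mem_filter.1 hx).2
    _ = (p : ℝ) * ∑ i ∈ range p, ∑ x ∈ K with u x ≠ 0, D (x + (i : ℤ) • e) := by
        rw [← Finset.mul_sum, Finset.sum_comm]
    _ ≤ (p : ℝ) * ∑ i ∈ range p, ∑ x ∈ K, D x :=
        mul_le_mul_of_nonneg_left (Finset.sum_le_sum hshift) (Nat.cast_nonneg _)
    _ = (p : ℝ) ^ 2 * ∑ x ∈ K, D x := by
        rw [Finset.sum_const, Finset.card_range, nsmul_eq_mul]; ring

/-! ## The spectral floor of the Dirichlet Laplacian matrix of a region in a slab -/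

/-- A finite window around `Λ`: it contains `Λ`, the backward unit translates of its points, and their forward `ν`-translates up to `p − 1` steps. -/
theorem exists_window (Λ : Finset (Site d)) (ν : Fin d) (p : ℕ) :
    ∃ K : Finset (Site d), Λ ⊆ K ∧ (∀ x ∈ Λ, ∀ i : Fin d, x - Pi.single i 1 ∈ K) ∧
      (∀ x ∈ Λ, ∀ i : ℕ, i < p → x + (i : ℤ) • (Pi.single ν (1 : ℤ) : Site d) ∈ K) := by
  classical
  refine ⟨(Λ ∪ Finset.univ.biUnion fun i : Fin d => Λ.image fun x => x - Pi.single i 1) ∪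
      (range p).biUnion fun i => Λ.image fun x => x + (i : ℤ) • (Pi.single ν (1 : ℤ) : Site d), ?_, ?_, ?_⟩
  · intro x hx
    exact Finset.mem_union_left _ (Finset.mem_union_left _ hx)
  · intro x hx i
    refine Finset.mem_union_left _ (Finset.mem_union_right _ ?_)
    exact Finset.mem_biUnion.2 ⟨i, Finset.mem_univ i, Finset.mem_image.2 ⟨x, hx, rfl⟩⟩
  · intro x hx i hi
    refine Finset.mem_union_right _ (Finset.mem_biUnion.2 ⟨i, Finset.mem_range.2 hi, ?_⟩)
    exact Finset.mem_image.2 ⟨x, hx, rfl⟩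

/-- **Slab Poincaré for the Dirichlet Laplacian matrix.**  If the finite region `Λ ⊆ ℤ^d` lies in a slab of width `p` in some lattice
direction (`a ≤ x_ν < a + p` on `Λ`), then `‖v‖² ≤ p² · vᵀ (dirichletMatrix Λ) v` for every `v : Λ → ℝ`, i.e.
`λ_min(−Δ_D^Λ) ≥ p⁻²` (the folklore bound `λ_min ≥ 2 − 2cos(π/(p+1))` with a crude constant). -/
theorem dotProduct_self_le_sq_mul_dotProduct_dirichletMatrix (Λ : Finset (Site d)) (ν : Fin d) (a : ℤ) (p : ℕ)
    (hΛ : ∀ x ∈ Λ, a ≤ x ν ∧ x ν < a + p) (v : Λ → ℝ) :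
    v ⬝ᵥ v ≤ (p : ℝ) ^ 2 * (v ⬝ᵥ (dirichletMatrix Λ *ᵥ v)) := by
  classical
  have hu0 : ∀ x ∉ Λ, zeroExtend Λ v x = 0 := fun x hx => zeroExtend_of_not_mem v hx
  have hmem : ∀ x, zeroExtend Λ v x ≠ 0 → x ∈ Λ := fun x hx => by
    by_contra h
    exact hx (hu0 x h)
  have hsupp : ∀ x, zeroExtend Λ v x ≠ 0 → a ≤ x ν ∧ x ν < a + p := fun x hx => hΛ x (hmem x hx)
  obtain ⟨K, hΛK, hKback, hKfwd⟩ := exists_window Λ ν p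
  have hK1 : ∀ x ∈ K, zeroExtend Λ v x ≠ 0 → ∀ i : ℕ, i < p →
      x + (i : ℤ) • (Pi.single ν (1 : ℤ) : Site d) ∈ K :=
    fun x _ hx i hi => hKfwd x (hmem x hx) i hi
  -- left-hand side
  have hL : v ⬝ᵥ v = ∑ x ∈ K, zeroExtend Λ v x ^ 2 := by
    calc v ⬝ᵥ v = ∑ y : Λ, zeroExtend Λ v y ^ 2 := by
          rw [dotProduct]
          exact Finset.sum_congr rfl fun y _ => by rw [zeroExtend_coe, sq]
      _ = ∑ x ∈ Λ, zeroExtend Λ v x ^ 2 := Finset.sum_coe_sort Λ (fun x => zeroExtend Λ v x ^ 2)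
      _ = ∑ x ∈ K, zeroExtend Λ v x ^ 2 :=
          Finset.sum_subset hΛK fun x _ hx => by rw [hu0 x hx, sq, mul_zero]
  -- right-hand side
  have hR : ∑ x ∈ K, (zeroExtend Λ v (x + Pi.single ν 1) - zeroExtend Λ v x) ^ 2 ≤
      v ⬝ᵥ (dirichletMatrix Λ *ᵥ v) := by
    have hsub : Function.support (fun x : Site d =>
        ∑ i : Fin d, (zeroExtend Λ v (x + Pi.single i 1) - zeroExtend Λ v x) ^ 2) ⊆ ↑K := by
      intro x hx
      rw [Function.mem_support] at hx
      obtain ⟨i, -, hi⟩ := Finset.exists_ne_zero_of_sum_ne_zero hx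
      by_cases h2 : zeroExtend Λ v x = 0
      · have h1 : zeroExtend Λ v (x + Pi.single i 1) ≠ 0 := by
          intro h1
          exact hi (by rw [h1, h2, sub_zero, sq, mul_zero])
        have hm := hKback (x + Pi.single i 1) (hmem _ h1) i
        rw [add_sub_cancel_right] at hm
        exact Finset.mem_coe.2 hm
      · exact Finset.mem_coe.2 (hΛK (hmem x h2))
    rw [dotProduct_dirichletMatrix_mulVec, dirichletForm_eq_finsum_sq Λ hu0,
      finsum_eq_sum_of_support_subset _ hsub]
    refine Finset.sum_le_sum fun x _ => ?_
    show (zeroExtend Λ v (x + Pi.single ν 1) - zeroExtend Λ v x) ^ 2 ≤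
      ∑ i : Fin d, (zeroExtend Λ v (x + Pi.single i 1) - zeroExtend Λ v x) ^ 2
    rw [← Finset.add_sum_erase Finset.univ _ (Finset.mem_univ ν)]
    exact le_add_of_nonneg_right (Finset.sum_nonneg fun i _ => sq_nonneg _)
  calc v ⬝ᵥ v = ∑ x ∈ K, zeroExtend Λ v x ^ 2 := hL
    _ ≤ (p : ℝ) ^ 2 * ∑ x ∈ K, (zeroExtend Λ v (x + Pi.single ν 1) - zeroExtend Λ v x) ^ 2 :=
        sum_sq_le_sq_mul_sum_sq_sub_single (zeroExtend Λ v) ν a p hsupp K hK1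
    _ ≤ (p : ℝ) ^ 2 * (v ⬝ᵥ (dirichletMatrix Λ *ᵥ v)) := mul_le_mul_of_nonneg_left hR (sq_nonneg _)

/-! ## The interior box `interiorSites H = [1, 2H−1]⁴` -/

section Interior

variable {H : ℕ}

/-- **Poincaré floor of the interior Dirichlet Laplacian**: `‖v‖² ≤ (2H−1)² · vᵀ(−Δ_I)v` on `interiorSites H` (slab of width `2H − 1` in direction `0`). -/
theorem interiorLaplacian_poincare (H : ℕ) (v : ↥(interiorSites H) → ℝ) :
    v ⬝ᵥ v ≤ ((2 * H - 1 : ℕ) : ℝ) ^ 2 * (v ⬝ᵥ (dirichletMatrix (interiorSites H) *ᵥ v)) := by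
  refine dotProduct_self_le_sq_mul_dotProduct_dirichletMatrix (interiorSites H) 0 1 (2 * H - 1) ?_ v
  intro x hx
  have h := Finset.mem_Icc.1 ((Fintype.mem_piFinset.1 hx) 0)
  rcases Nat.eq_zero_or_pos H with rfl | hH
  · simp only [Nat.cast_zero, mul_zero, zero_sub] at h
    omega
  · rw [Nat.cast_sub (by omega : 1 ≤ 2 * H)]
    push_cast
    omega

/-- The same floor as `λ_min(−Δ_I) ≥ (1/4)/H²`: `(1/4)/H² · ‖v‖² ≤ vᵀ(−Δ_I)v` for `H ≥ 1`. -/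
theorem interiorLaplacian_floor (hH : 1 ≤ H) (v : ↥(interiorSites H) → ℝ) :
    1 / 4 / (H : ℝ) ^ 2 * (v ⬝ᵥ v) ≤ v ⬝ᵥ (dirichletMatrix (interiorSites H) *ᵥ v) := by
  have h := interiorLaplacian_poincare H v
  have hH' : (1 : ℝ) ≤ H := by exact_mod_cast hH
  have hp : ((2 * H - 1 : ℕ) : ℝ) = 2 * H - 1 := by
    rw [Nat.cast_sub (by omega : 1 ≤ 2 * H)]; push_cast; ring
  rw [hp] at h
  have hvv : 0 ≤ v ⬝ᵥ v := Finset.sum_nonneg fun i _ => mul_self_nonneg _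
  have hQ : 0 ≤ v ⬝ᵥ (dirichletMatrix (interiorSites H) *ᵥ v) := by
    have hpos : 0 < (2 * (H : ℝ) - 1) ^ 2 := by nlinarith
    by_contra hneg
    push Not at hneg
    have := mul_neg_of_pos_of_neg hpos hneg
    linarith
  have hH2 : 0 < (H : ℝ) ^ 2 := by positivity
  rw [div_mul_eq_mul_div, div_le_iff₀ hH2]
  nlinarith

/-- **Operator floor of the interior Dirichlet Laplacian** (STEP1b §2 (4f), first clause, `λ_min((−Δ_I)ᵀ(−Δ_I)) ≥ (1/16)/H⁴`):
`(1/16)/H⁴ · ‖v‖² ≤ ‖(−Δ_I)v‖²` for `H ≥ 1`. -/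
theorem interiorLaplacian_opFloor (hH : 1 ≤ H) (v : ↥(interiorSites H) → ℝ) :
    1 / 16 / (H : ℝ) ^ 4 * (v ⬝ᵥ v) ≤
      (dirichletMatrix (interiorSites H) *ᵥ v) ⬝ᵥ (dirichletMatrix (interiorSites H) *ᵥ v) := by
  have h := dotProduct_self_le_sq_mul_of_le_mul_dotProduct v (dirichletMatrix (interiorSites H) *ᵥ v) (sq_nonneg _)
    (interiorLaplacian_poincare H v)
  have hH' : (1 : ℝ) ≤ H := by exact_mod_cast hH
  have hp : ((2 * H - 1 : ℕ) : ℝ) = 2 * H - 1 := by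
    rw [Nat.cast_sub (by omega : 1 ≤ 2 * H)]; push_cast; ring
  rw [hp] at h
  have hvv : 0 ≤ v ⬝ᵥ v := Finset.sum_nonneg fun i _ => mul_self_nonneg _
  have hQ : 0 ≤ (dirichletMatrix (interiorSites H) *ᵥ v) ⬝ᵥ (dirichletMatrix (interiorSites H) *ᵥ v) :=
    Finset.sum_nonneg fun i _ => mul_self_nonneg _
  have hH4 : 0 < (H : ℝ) ^ 4 := by positivity
  rw [div_mul_eq_mul_div, div_le_iff₀ hH4]
  have h16 : ((2 * (H : ℝ) - 1) ^ 2) ^ 2 ≤ 16 * (H : ℝ) ^ 4 := by nlinarith [sq_nonneg (2 * (H : ℝ) - 1)]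
  nlinarith

/-- `−Δ_I` is invertible. -/
theorem isUnit_det_interiorLaplacian (H : ℕ) : IsUnit (dirichletMatrix (interiorSites H)).det :=
  isUnit_det_dirichletMatrix (by norm_num) _

/-- **Green-form bound**: `vᵀ(−Δ_I)⁻¹v ≤ 4H² · ‖v‖²` for `H ≥ 1` (`λ_max(Δ_I⁻¹) ≤ 4H²`). -/
theorem interiorLaplacian_inv_form_le (hH : 1 ≤ H) (v : ↥(interiorSites H) → ℝ) :
    v ⬝ᵥ ((dirichletMatrix (interiorSites H))⁻¹ *ᵥ v) ≤ 4 * (H : ℝ) ^ 2 * (v ⬝ᵥ v) := by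
  refine dotProduct_inv_mulVec_le_of_floor _ (isUnit_det_interiorLaplacian H) (by positivity) (fun w => ?_) v
  have h := interiorLaplacian_floor hH w
  have hH2 : 0 < (H : ℝ) ^ 2 := by
    have : (1 : ℝ) ≤ H := by exact_mod_cast hH
    positivity
  rw [div_mul_eq_mul_div, div_le_iff₀ hH2] at h
  linarith

/-- **Inverse operator bound**: `‖(−Δ_I)⁻¹w‖² ≤ 16H⁴ · ‖w‖²` for `H ≥ 1` (`‖Δ_I⁻¹‖₂ ≤ 4H²`). -/
theorem interiorLaplacian_inv_opBound (hH : 1 ≤ H) (w : ↥(interiorSites H) → ℝ) :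
    ((dirichletMatrix (interiorSites H))⁻¹ *ᵥ w) ⬝ᵥ ((dirichletMatrix (interiorSites H))⁻¹ *ᵥ w) ≤
      16 * (H : ℝ) ^ 4 * (w ⬝ᵥ w) := by
  have h := inv_opBound_of_opFloor _ (isUnit_det_interiorLaplacian H) (interiorLaplacian_opFloor hH) w
  have hH4 : 0 < (H : ℝ) ^ 4 := by
    have : (1 : ℝ) ≤ H := by exact_mod_cast hH
    positivity
  rw [div_mul_eq_mul_div, div_le_iff₀ hH4] at h
  linarith

end Interior

end SpectralFloor

end Summit.QuantumFields.YangMills.Theorems.AllWindowsColdBoxBoxHighLine
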